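import Summits.Ventures.HodgeRepro.Tier4.Line1.ThreeLines
import Summits.Ventures.HodgeRepro.Tier4.Line1.RationalRotation

/-!
# Tier4/Line1/RegularElement — LINE L1: a regular rational element exists (J2.d′-i, row convention) (t4-L1-p3)

Blind re-derivation cell `pub-hodge-repro`, Tier 4 (README §9–§10), seat t4-L1-p3.  The «declared wall» J2.d′-i
`exists_regular_rational` of the line (Skeleton v0.13 L433–L435) PROVED in the convention of typer-2's `unitaryGroup`
(`{g | g Ω = Ω g ∧ g B gᵀ = B}`, row vectors): `exists_regular_rational_row` — for a definite plane with `Ω² = −d`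
(`−d` not a square), the row-hermitian relations `Ω B = −B Ωᵀ`, `P i B = B (P i)ᵀ` and rank-2 projectors, some rational
point of `U(W)(𝔸)` is regular (`IsRegularRational`).  Either `im (Q 0)` differs from both `P`-lines and `γ₀ = 1` is
regular (`isRegularRational_one'`, = `ThreeLines.isRegularRational_one` without the `IsGenuine` binder), or `im (Q 0)`
is a `P`-line and the rational rotation `γ` of `RationalRotation.exists_rational_rotation` is regular: `t⁻¹ γ t′ = γ`
makes `t` commute with the rank-2 `Ω`-stable projector `γ Q₀ γ⁻¹`, whose image contains `γ q` with both `P`-components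
non-zero, so `t` is an `E′`-scalar (`ThreeLines.mat_eq_scalar_of_three_lines`), hence central, and `t′ = γ⁻¹ t γ = t`.
No Witt theorem, no density of rational points (STATUS.md S12438).  The byte-identical `exists_regular_rational` follows
the minute `IsGenuine` carries the row relations (PlaneDefs v0.2, the fix of INTERFACE DEFECT L1-#1, S12500).

Nothing here says anything about the status of the Hodge conjecture for CM abelian varieties, which is NOT proved
(HC_CM is NOT proved by anyone in this repository).
-/

set_option autoImplicit false

noncomputable section

namespace Summit.Ventures.HodgeRepro.Tier4.Line1

open NumberField Summit.Ventures.HodgeRepro.Tier4.Common Matrix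

variable {k : Type} [Field k] [NumberField k] (W : PlaneData k)

/-- `isRegularRational_one` with the genuineness data given explicitly (no `IsGenuine` binder): the identity is
regular when the line `im (Q 0)` differs from both `P`-lines. -/
theorem isRegularRational_one' {d : k} (hΩ : W.Ω * W.Ω = -(d • (1 : Matrix (Fin 4) (Fin 4) k)))
    (hd : ¬ IsSquare (-d)) (hPr : ∀ i, (W.P i).rank = 2) (hQr : (W.Q 0).rank = 2)
    (hQ0 : LinearMap.range (W.Q 0).mulVecLin ≠ LinearMap.range (W.P 0).mulVecLin)
    (hQ1 : LinearMap.range (W.Q 0).mulVecLin ≠ LinearMap.range (W.P 1).mulVecLin) :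
    IsRegularRational W 1 := by
  intro t ht t' ht' hγ
  have h1 : t' = t := by
    have h : t⁻¹ * t' = 1 := by simpa using hγ
    exact (inv_mul_eq_one.mp h).symm
  subst h1
  refine ⟨⟨⟨ht, ht'⟩, ?_⟩, rfl⟩
  obtain ⟨z, hzQ, hx, hy⟩ := exists_mem_range_components_ne_zero W hΩ hd (hPr 0) (hPr 1)
    (W.Q_comm 0) hQr hQ0 hQ1
  obtain ⟨c, e, hce⟩ := mat_eq_scalar_of_three_lines W hΩ hd (hPr 0) (hPr 1) (W.Q_comm 0) hQr
    hzQ hx hy t' ht.1 ht.2 ht'.1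
  exact mem_center_of_mat_eq_scalar W t' hce

/-- **a regular rational element exists** (J2.d′-i in the row convention of `unitaryGroup`): for a definite plane with
`Ω² = −d` (`−d` not a square), the row-hermitian relations `Ω B = −B Ωᵀ`, `P i B = B (P i)ᵀ` and rank-2 projectors,
some rational point of `U(W)` is regular — `γ₀ = 1` when `im (Q 0)` differs from both `P`-lines, the rational rotation
`B r B⁻¹` otherwise.  No Witt theorem, no density of rational points. -/
theorem exists_regular_rational_row (hW : IsDefinite W) {d : k}
    (hΩ : W.Ω * W.Ω = -(d • (1 : Matrix (Fin 4) (Fin 4) k))) (hd : ¬ IsSquare (-d))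
    (hrow : W.Ω * W.B = -(W.B * W.Ωᵀ)) (hPB : ∀ i, W.P i * W.B = W.B * (W.P i)ᵀ)
    (hPr : ∀ i, (W.P i).rank = 2) (hQr : ∀ i, (W.Q i).rank = 2) :
    ∃ γ₀ : rationalPoints W, IsRegularRational W γ₀ := by
  classical
  by_cases hgood : LinearMap.range (W.Q 0).mulVecLin ≠ LinearMap.range (W.P 0).mulVecLin ∧
      LinearMap.range (W.Q 0).mulVecLin ≠ LinearMap.range (W.P 1).mulVecLin
  · exact ⟨1, isRegularRational_one' W hΩ hd hPr (hQr 0) hgood.1 hgood.2⟩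
  · have hbad : ∃ i : Fin 2,
        LinearMap.range (W.Q 0).mulVecLin = LinearMap.range (W.P i).mulVecLin := by
      rcases not_and_or.mp hgood with h | h
      · exact ⟨0, not_not.mp h⟩
      · exact ⟨1, not_not.mp h⟩
    obtain ⟨i, hi⟩ := hbad
    obtain ⟨γk, hγΩ, hγB, hγu, hγgen⟩ := exists_rational_rotation W hW hΩ hd hrow hPB hPr
    have hγdet : IsUnit γk.det := (Matrix.isUnit_iff_isUnit_det γk).mp hγu
    have hγγ : γk * γk⁻¹ = 1 := Matrix.mul_nonsing_inv γk hγdet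
    have hγγ' : γk⁻¹ * γk = 1 := Matrix.nonsing_inv_mul γk hγdet
    -- the lift to `G(𝔸_k)`
    set u : GL (Fin 4) k := hγu.unit with hudef
    have hu : (u : Matrix (Fin 4) (Fin 4) k) = γk := hγu.unit_spec
    set g : GL4 k := Matrix.GeneralLinearGroup.map (algebraMap k (Ad k)) u with hgdef
    have hg : (g : M4 k) = adMat k γk := by
      ext a b
      rw [hgdef]
      show (algebraMap k (Ad k)) (u a b) = (adMat k γk) a b
      rw [adMat, Matrix.map_apply, ← hu]
    have hgmem : g ∈ unitaryGroup W := by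
      rw [mem_unitaryGroup, hg]
      constructor
      · rw [← adMat_mul, ← adMat_mul, hγΩ]
      · rw [← adMat_transpose, ← adMat_mul, ← adMat_mul, hγB]
    set γ : GA W := ⟨g, hgmem⟩ with hγdef
    have hγrat : γ ∈ rationalPoints W := by
      rw [rationalPoints, Subgroup.mem_subgroupOf]
      exact ⟨u, rfl⟩
    have hγmat : GA.mat W γ = adMat k γk := hg
    have hγinv : GA.mat W γ⁻¹ = adMat k γk⁻¹ := by
      have h1 : (GA.mat W γ)⁻¹ = GA.mat W γ⁻¹ := Matrix.inv_eq_left_inv (GA.mat_inv_mul W γ)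
      have h2 : (adMat k γk)⁻¹ = adMat k γk⁻¹ :=
        Matrix.inv_eq_left_inv (by rw [← adMat_mul, hγγ', adMat_one])
      rw [← h1, hγmat, h2]
    refine ⟨⟨γ, hγrat⟩, ?_⟩
    intro t ht t' ht' hγeq
    -- `t' = γ⁻¹ t γ`
    have ht'eq : t' = γ⁻¹ * t * γ := by
      have h : t⁻¹ * γ * t' = γ := hγeq
      calc t' = (t⁻¹ * γ)⁻¹ * (t⁻¹ * γ * t') := by group
        _ = γ⁻¹ * t * γ := by rw [h]; group
    -- `t` commutes with `f = γ Q₀ γ⁻¹`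
    have hf : GA.mat W t * adMat k (γk * W.Q 0 * γk⁻¹) = adMat k (γk * W.Q 0 * γk⁻¹) * GA.mat W t := by
      have h1 : GA.mat W t' * adMat k (W.Q 0) = adMat k (W.Q 0) * GA.mat W t' := ht'.1
      rw [ht'eq] at h1
      have h2 : GA.mat W (γ⁻¹ * t * γ) = adMat k γk⁻¹ * GA.mat W t * adMat k γk := by
        rw [GA.mat_mul, GA.mat_mul, hγinv, hγmat]
      rw [h2] at h1
      have hA : adMat k γk * adMat k γk⁻¹ = 1 := by rw [← adMat_mul, hγγ, adMat_one]
      have hA' : adMat k γk⁻¹ * adMat k γk = 1 := by rw [← adMat_mul, hγγ', adMat_one]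
      rw [adMat_mul, adMat_mul]
      calc GA.mat W t * (adMat k γk * adMat k (W.Q 0) * adMat k γk⁻¹)
          = adMat k γk * ((adMat k γk⁻¹ * GA.mat W t * adMat k γk) * adMat k (W.Q 0)) * adMat k γk⁻¹ := by
            simp only [Matrix.mul_assoc]
            rw [← Matrix.mul_assoc (adMat k γk) (adMat k γk⁻¹), hA, Matrix.one_mul]
        _ = adMat k γk * (adMat k (W.Q 0) * (adMat k γk⁻¹ * GA.mat W t * adMat k γk)) * adMat k γk⁻¹ := by
            rw [h1]
        _ = adMat k γk * adMat k (W.Q 0) * adMat k γk⁻¹ * GA.mat W t := by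
            simp only [Matrix.mul_assoc]
            rw [hA, Matrix.mul_one]
    -- the conjugated projector is a rank-2 `Ω`-stable matrix
    have hγinvΩ : γk⁻¹ * W.Ω = W.Ω * γk⁻¹ := by
      calc γk⁻¹ * W.Ω = γk⁻¹ * W.Ω * (γk * γk⁻¹) := by rw [hγγ, Matrix.mul_one]
        _ = γk⁻¹ * (γk * W.Ω) * γk⁻¹ := by rw [hγΩ]; simp only [Matrix.mul_assoc]
        _ = W.Ω * γk⁻¹ := by rw [← Matrix.mul_assoc, hγγ', Matrix.one_mul]
    have hfΩ : γk * W.Q 0 * γk⁻¹ * W.Ω = W.Ω * (γk * W.Q 0 * γk⁻¹) := by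
      calc γk * W.Q 0 * γk⁻¹ * W.Ω = γk * W.Q 0 * (γk⁻¹ * W.Ω) := by simp only [Matrix.mul_assoc]
        _ = γk * (W.Q 0 * W.Ω) * γk⁻¹ := by rw [hγinvΩ]; simp only [Matrix.mul_assoc]
        _ = γk * (W.Ω * W.Q 0) * γk⁻¹ := by rw [W.Q_comm 0]
        _ = (γk * W.Ω) * W.Q 0 * γk⁻¹ := by simp only [Matrix.mul_assoc]
        _ = W.Ω * (γk * W.Q 0 * γk⁻¹) := by rw [hγΩ]; simp only [Matrix.mul_assoc]
    have hfr : (γk * W.Q 0 * γk⁻¹).rank = 2 := by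
      rw [Matrix.rank_mul_eq_left_of_isUnit_det _ _ (Matrix.isUnit_nonsing_inv_det γk hγdet),
        Matrix.rank_mul_eq_right_of_isUnit_det _ _ hγdet]
      exact hQr 0
    -- a vector of `im f` with both `P`-components non-zero
    have hneQ : LinearMap.range (W.Q 0).mulVecLin ≠ ⊥ := by
      intro h
      have h2 : Module.finrank k (LinearMap.range (W.Q 0).mulVecLin) = 2 := hQr 0
      rw [h, finrank_bot] at h2
      exact absurd h2 (by norm_num)
    obtain ⟨q, hqQ, hq0⟩ := Submodule.exists_mem_ne_zero_of_ne_bot hneQ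
    have hqP : q ∈ LinearMap.range (W.P i).mulVecLin := hi ▸ hqQ
    obtain ⟨hz0, hz1⟩ := hγgen i q hqP hq0
    have hzf : γk *ᵥ q ∈ LinearMap.range (γk * W.Q 0 * γk⁻¹).mulVecLin := by
      obtain ⟨q', hq'⟩ := hqQ
      simp only [mulVecLin_apply] at hq'
      refine ⟨γk *ᵥ q', ?_⟩
      simp only [mulVecLin_apply]
      rw [mulVec_mulVec, Matrix.mul_assoc, Matrix.mul_assoc, hγγ', Matrix.mul_one, ← mulVec_mulVec, hq']
    obtain ⟨c, e, hce⟩ := mat_eq_scalar_of_three_lines W hΩ hd (hPr 0) (hPr 1) hfΩ hfr hzf hz0 hz1 t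
      ht.1 ht.2 hf
    have hcenter : t ∈ Subgroup.center (GA W) := mem_center_of_mat_eq_scalar W t hce
    have ht't : t' = t := by
      rw [ht'eq]
      have h := (Subgroup.mem_center_iff.mp hcenter) γ
      calc γ⁻¹ * t * γ = γ⁻¹ * (γ * t) := by rw [mul_assoc, ← h]
        _ = t := inv_mul_cancel_left γ t
    refine ⟨⟨⟨ht, ht't ▸ ht'⟩, hcenter⟩, ht't⟩


end Summit.Ventures.HodgeRepro.Tier4.Line1
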